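import Literature.Analysis.FluidPDE.PeriodicLeraySystem
import Literature.Analysis.FluidPDE.WeakL3CaloricExtension
import Literature.Analysis.FluidPDE.LeraySelfSimilarCalculus
import Literature.Analysis.FluidPDE.WholeSpaceIBP
import Literature.Analysis.FluidPDE.PeriodicLerayTransportLocalEnergy
import Literature.Analysis.FluidPDE.PeriodicLerayTransportDistributional
import HarnessLib

/-!
# [BT1] Lemma 3.4, discharged: the similarity profile of weak-`L³` DSS data satisfies
# Assumption 2.1

Analysis/FluidPDE proof file (theorems only), sibling of `PeriodicLeraySystem.lean`: the
**discharge of the named fact `Literature.Analysis.FluidPDE.bradshawTsai2017_lemma_3_4`**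
(Bradshaw–Tsai, *Forward discretely self-similar solutions of the Navier–Stokes equations II*,
Ann. Henri Poincaré 18 (2017) = arXiv:1510.07504 [BT1], Lemma 3.4, p. 12): for a divergence
free, `λ`-DSS datum `v₀ ∈ L³_w(ℝ³)` (`λ > 1`) the profile `U₀(y,s) = √(2t) (e^{tΔ}v₀)(x)`,
`y = x/√(2t)`, `s = log √(2t)` (`BradshawTsai2017.similarityProfile v₀ s y = eˢ (e^{tΔ}v₀)(eˢy)`,
`t = e^{2s}/2`) satisfies Assumption 2.1 (`BradshawTsai2017.ProfileAssumption (log λ) q U₀`) for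
every `q ∈ (3, ∞]`:
`theorem bradshawTsai2017_lemma_3_4_holds : bradshawTsai2017_lemma_3_4`.

Proof, following the printed one (p. 12) clause by clause, with `V = e^{tΔ}v₀`
(`UnboundedOperators.heatExtension v₀`), `σ = eˢ`, `t = σ²/2`, `U₀(s) = σ V(t)(σ ·)`:

* *"Inclusion in `C¹` comes from the smoothing effect of the heat kernel"*: `V` is jointly `C^∞`
  on `(0,∞) × ℝ³` (`MemWeakLp.contDiffOn_heatExtension_prod`, the weak-`L³` datum being split as
  `L¹ + L⁴`), and `(s,y) ↦ (e^{2s}/2, eˢy)` is smooth into that slab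
  (`contDiff_uncurry_similarityProfile`).
* *"`U₀` is … `T`-periodic for `T = log λ`"*: `similarityProfile_add_log` (already in
  `PeriodicLeraySystem.lean`, from the DSS covariance of the caloric extension).
* *"`U₀` is divergence free"*: `div U₀(s)(y) = σ² (div V(t))(σy) = 0`
  (`divergence_smul_comp_smul`, `MemWeakLp.isDivFree_heatExtension`: weakly divergence-free
  tempered data have divergence-free caloric extensions).
* *"`LU₀ = ∂ₛU₀ − ΔU₀ − U₀ − y·∇U₀ = 0`"*: the chain rule gives
  `∂ₛU₀ = U₀ + σ³ (∂ₜV)(t)(σy) + σ² DV(t)(σy)[y]`, `y·∇U₀ = σ² DV(t)(σy)[y]`, `ΔU₀ = σ³ (ΔV(t))(σy)`,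
  and `∂ₜV = ΔV` (`MemWeakLp.hasDerivAt_heatExtension_time`), so `∂ₛU₀ − U₀ − y·∇U₀ = ΔU₀`
  pointwise (`timeDeriv_similarityProfile_sub_eq_laplacian`); the weak form (2.3) against
  `ζ ∈ C_c^∞` then is Green's first identity `∫⟪ΔU₀, ζ⟫ + ∫ ∇U₀ : ∇ζ = 0`
  (`integral_inner_laplacian_add_frobeniusInner_eq_zero`, from the tree's
  `integral_inner_laplacian_add_eq_zero`).
* *"`U₀ ∈ L^∞(0,T; L⁴ ∩ L^q)`"*: by periodicity it suffices to take `s ∈ [0,T)`, where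
  `t ∈ [1/2, λ²/2]` and `σ ∈ [1, λ]`; `‖U₀(s)‖_{L^q(|y|≥R)} ≤ λ ‖V(t)‖_{L^q(|x| ≥ R)}` for such `s`
  (`eLpNorm_comp_smul_restrict_compl_ball_le`: dilation by `σ ≥ 1` does not increase `L^q` norms
  of exterior regions), and `sup_{t ≥ 1/2} ‖V(t)‖_q < ∞`
  (`MemWeakLp.exists_forall_eLpNorm_heatExtension_le`).
* *"The last bound in Assumption 2.1 is a direct consequence of Lemma 3.2"*: with
  `Θ(R) = sup_s ‖U₀(s)‖_{L^q(|y| ≥ R)}`, `Θ(R) → 0` by [BT1] Lemma 3.2 in the form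
  `MemWeakLp.exists_forall_eLpNorm_heatExtension_restrict_compl_ball_le` (uniform tails of `V(t)`
  for `t ∈ [1/2, λ²/2]`).

The only deviation from the printed argument is inside Lemma 3.2 (truncation `L³_w ⊂ L¹ + L⁴`
instead of Lemma 3.1 and dyadic shells; see `WeakL3CaloricExtension.lean`); the statement
discharged is the vendored one, unchanged.

## [BT1] §4 ¶1–3, discharged: `bradshawTsai2017_ansatz_transport_holds`

The last section of this file assembles the **discharge of the named fact
`Literature.Analysis.FluidPDE.bradshawTsai2017_ansatz_transport`** (same source, §4, proof of
Thm 1.2, ¶1–3 and last paragraph): for `λ > 1`, `T = log λ`, a profile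
`U₀ = similarityProfile v₀` under Assumption 2.1 and a suitable periodic weak solution `(u, p)`
with `p ∈ L^{5/3}(ℝ³ × [0,T])`, the physical pair `v = u(y,s)/√(2t)`, `π = p(y,s)/(2t)` is an
ansatz pair (`IsAnsatzSolution λ v₀ v π`). The clauses are proved in the sibling files of the
transport series — `PeriodicLerayTransport` (energy bound, `π ∈ L^{5/3}`),
`PeriodicLerayTransportGradient` (weak gradient of `v − e^{tΔ}v₀`, `∇_x v = (2t)⁻¹∇_y u`),
`PeriodicLerayTransportIntegrability`/`PeriodicLerayGradient` (local classes, a.e. periodicity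
of `∇u`), `PeriodicLerayTransportDistributional` (distributional Navier–Stokes equations, energy
and pressure classes on the slab) and `PeriodicLerayTransportLocalEnergy` ((2.4) ⟹ (2.5)) — and
put together here as `IsSuitablePeriodicWeakSolution.isSuitableWeakSolutionOn_phys` (suitability
on the slab `t > 0`, Caffarelli–Kohn–Nirenberg) and
`theorem bradshawTsai2017_ansatz_transport_holds : bradshawTsai2017_ansatz_transport`.

## References

* Z. Bradshaw, T.-P. Tsai, Ann. Henri Poincaré 18 (2017) 1095–1119 = arXiv:1510.07504, Lemma 3.4
  (with Lemmas 3.1–3.2 and Assumption 2.1) [BradshawTsai2017AHP].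
* J. Leray, Acta Math. 63 (1934), §6 (1.11) (integration by parts on the whole space) [Leray1934].
-/

noncomputable section

open MeasureTheory Set Function Filter Metric TopologicalSpace InnerProductSpace
open _root_.Topology
open scoped NNReal ENNReal Laplacian RealInnerProductSpace

namespace Literature.Analysis.FluidPDE

open UnboundedOperators FunctionSpaces

/-! ### Dilations do not increase `L^q` norms over exterior regions -/

section Dilation

variable {E : Type*} [NormedAddCommGroup E] [InnerProductSpace ℝ E] [FiniteDimensional ℝ E]
  [MeasurableSpace E] [BorelSpace E]
variable {F : Type*} [NormedAddCommGroup F]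

omit [InnerProductSpace ℝ E] [FiniteDimensional ℝ E] [MeasurableSpace E] [BorelSpace E] in
/-- The preimage of the exterior region `{‖x‖ ≥ σR}` under the dilation `y ↦ σy`, `σ > 0`, is
`{‖y‖ ≥ R}`. [folklore] -/
theorem preimage_smul_compl_ball [NormedSpace ℝ E] {σ : ℝ} (hσ : 0 < σ) (R : ℝ) :
    (fun y : E => σ • y) ⁻¹' (ball (0 : E) (σ * R))ᶜ = (ball (0 : E) R)ᶜ := by
  ext y
  simp only [mem_preimage, mem_compl_iff, mem_ball_zero_iff, norm_smul, Real.norm_of_nonneg hσ.le,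
    not_lt]
  exact ⟨fun h => le_of_mul_le_mul_left h hσ, fun h => mul_le_mul_of_nonneg_left h hσ.le⟩

omit [InnerProductSpace ℝ E] [FiniteDimensional ℝ E] [MeasurableSpace E] [BorelSpace E] in
/-- For `σ ≥ 1` the exterior region `{‖x‖ ≥ σR}` is contained in `{‖x‖ ≥ R}`. [folklore] -/
theorem compl_ball_mul_subset {σ : ℝ} (hσ : 1 ≤ σ) (R : ℝ) :
    (ball (0 : E) (σ * R))ᶜ ⊆ (ball (0 : E) R)ᶜ := by
  rcases le_or_gt R 0 with hR | hR
  · rw [ball_eq_empty.2 hR, compl_empty]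
    exact subset_univ _
  · exact compl_subset_compl.2 (ball_subset_ball (le_mul_of_one_le_left hR.le hσ))

/-- **Dilation by `σ ≥ 1` does not increase `L^q` norms of exterior regions**:
`‖f(σ ·)‖_{L^q(‖y‖ ≥ R)} ≤ ‖f‖_{L^q(‖x‖ ≥ R)}` for every `f`, `q ∈ [0, ∞]`, `R ∈ ℝ` (change of
variables `x = σy`: the left side is `σ^{-n/q} ‖f‖_{L^q(‖x‖ ≥ σR)}`, and `σ^{-n/q} ≤ 1`,
`{‖x‖ ≥ σR} ⊆ {‖x‖ ≥ R}`). [folklore] -/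
theorem eLpNorm_comp_smul_restrict_compl_ball_le (f : E → F) (q : ℝ≥0∞) {σ : ℝ} (hσ : 1 ≤ σ)
    (R : ℝ) :
    eLpNorm (fun y => f (σ • y)) q (volume.restrict (ball (0 : E) R)ᶜ) ≤
      eLpNorm f q (volume.restrict (ball (0 : E) R)ᶜ) := by
  have hσ0 : 0 < σ := one_pos.trans_le hσ
  have hemb : MeasurableEmbedding (fun y : E => σ • y) :=
    (Homeomorph.smul (Units.mk0 σ hσ0.ne')).measurableEmbedding
  set k : ℝ≥0∞ := ENNReal.ofReal |(σ ^ Module.finrank ℝ E)⁻¹| with hk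
  have hk1 : k ≤ 1 := by
    rw [hk, abs_of_pos (inv_pos.2 (pow_pos hσ0 _))]
    exact ENNReal.ofReal_le_one.2 (inv_le_one_of_one_le₀ (one_le_pow₀ hσ))
  -- change of variables
  have hmap : Measure.map (fun y : E => σ • y) (volume.restrict (ball (0 : E) R)ᶜ) =
      k • volume.restrict (ball (0 : E) (σ * R))ᶜ := by
    rw [← preimage_smul_compl_ball hσ0 R, ← hemb.restrict_map, Measure.map_addHaar_smul _ hσ0.ne',
      Measure.restrict_smul]
  rw [← Function.comp_def f, ← hemb.eLpNorm_map_measure, hmap]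
  rcases eq_or_ne k 0 with hk0 | hk0
  · simp [hk0]
  rw [eLpNorm_smul_measure_of_ne_zero hk0, smul_eq_mul]
  calc k ^ (1 / q).toReal * eLpNorm f q (volume.restrict (ball (0 : E) (σ * R))ᶜ)
      ≤ 1 * eLpNorm f q (volume.restrict (ball (0 : E) R)ᶜ) :=
        mul_le_mul' (ENNReal.rpow_le_one hk1 ENNReal.toReal_nonneg)
          (eLpNorm_mono_measure _ (Measure.restrict_mono (compl_ball_mul_subset hσ R) le_rfl))
    _ = _ := one_mul _

/-- Whole-space case of `eLpNorm_comp_smul_restrict_compl_ball_le`: `‖f(σ ·)‖_q ≤ ‖f‖_q` for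
`σ ≥ 1`. [folklore] -/
theorem eLpNorm_comp_smul_le (f : E → F) (q : ℝ≥0∞) {σ : ℝ} (hσ : 1 ≤ σ) :
    eLpNorm (fun y => f (σ • y)) q volume ≤ eLpNorm f q volume := by
  have h := eLpNorm_comp_smul_restrict_compl_ball_le f q hσ 0
  rwa [ball_zero, compl_empty, Measure.restrict_univ] at h

end Dilation

/-! ### Green's first identity in the Frobenius form of [BT1] (2.2)–(2.3) -/

section Green

variable {E : Type*} [NormedAddCommGroup E] [InnerProductSpace ℝ E] [FiniteDimensional ℝ E]
  [MeasurableSpace E] [BorelSpace E]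
variable {F' : Type*} [NormedAddCommGroup F'] [InnerProductSpace ℝ F']

/-- **Green's first identity, Frobenius form**: for `u ∈ C²(E; F')` and a compactly supported
`ζ ∈ C¹(E; F')`, `∫ (⟪Δu, ζ⟫ + Du : Dζ) = 0`, where `A : B = Σᵢ ⟪A eᵢ, B eᵢ⟫` is
`frobeniusInner` over the standard orthonormal frame (the tree's
`integral_inner_laplacian_add_eq_zero`, Leray 1934 §6 (1.11), with the sum taken inside the
integral). [cite: Leray1934, §6 (1.11) p. 203] -/
theorem integral_inner_laplacian_add_frobeniusInner_eq_zero {u ζ : E → F'} (hu : ContDiff ℝ 2 u)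
    (hζ : ContDiff ℝ 1 ζ) (hζc : HasCompactSupport ζ) :
    ∫ y, (⟪(Δ u) y, ζ y⟫ + frobeniusInner (fderiv ℝ u y) (fderiv ℝ ζ y)) = 0 := by
  set b := stdOrthonormalBasis ℝ E with hb
  have hgreen := integral_inner_laplacian_add_eq_zero b hu hζ (Or.inr hζc)
  have hu1 : ContDiff ℝ 1 u := hu.of_le one_le_two
  have hDu : Continuous (fderiv ℝ u) := hu1.continuous_fderiv one_ne_zero
  have hDζ : Continuous (fderiv ℝ ζ) := hζ.continuous_fderiv one_ne_zero
  have hDζc : HasCompactSupport (fderiv ℝ ζ) := hζc.fderiv (𝕜 := ℝ)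
  -- integrability of the summands
  have hi₀ : Integrable (fun y => ⟪(Δ u) y, ζ y⟫) (volume : Measure E) := by
    refine ((continuous_laplacian hu).inner hζ.continuous).integrable_of_hasCompactSupport
      (hζc.mono fun y hy => ?_)
    contrapose! hy
    simp only [mem_support, not_not] at hy
    simp [hy]
  have hiᵢ : ∀ i, Integrable (fun y => ⟪fderiv ℝ u y (b i), fderiv ℝ ζ y (b i)⟫)
      (volume : Measure E) := fun i => by
    refine ((hDu.clm_apply continuous_const).inner
      (hDζ.clm_apply continuous_const)).integrable_of_hasCompactSupport (hDζc.mono fun y hy => ?_)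
    contrapose! hy
    simp only [mem_support, not_not] at hy
    simp [hy]
  have hiF : Integrable (fun y => frobeniusInner (fderiv ℝ u y) (fderiv ℝ ζ y))
      (volume : Measure E) := by
    simp only [frobeniusInner]
    exact integrable_finsetSum _ fun i _ => hiᵢ i
  rw [integral_add hi₀ hiF]
  simp only [frobeniusInner]
  rw [integral_finsetSum _ fun i _ => hiᵢ i]
  exact hgreen

end Green

/-! ### The chain rule through a jointly differentiable two-variable function -/

section ChainRule

variable {X : Type*} [NormedAddCommGroup X] [NormedSpace ℝ X]
variable {G : Type*} [NormedAddCommGroup G] [NormedSpace ℝ G]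

/-- **Splitting a joint derivative into partial derivatives.** If `W : ℝ × X → G` is
differentiable at `(t, x)`, then `DW(t,x)[(a, b)] = a • ∂ₜW(t,x) + D(W(t,·))(x)[b]`, the partial
derivatives being those of the slices `τ ↦ W(τ,x)` and `x' ↦ W(t,x')`. [folklore] -/
theorem fderiv_apply_prod_eq_of_differentiableAt {W : ℝ × X → G} {t : ℝ} {x : X}
    (hW : DifferentiableAt ℝ W (t, x)) (a : ℝ) (b : X) :
    fderiv ℝ W (t, x) (a, b) =
      a • deriv (fun τ => W (τ, x)) t + fderiv ℝ (fun x' => W (t, x')) x b := by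
  have h1 : HasDerivAt (fun τ => W (τ, x)) (fderiv ℝ W (t, x) (1, 0)) t := by
    have := hW.hasFDerivAt.comp_hasDerivAt t ((hasDerivAt_id t).prodMk (hasDerivAt_const t x))
    simpa [Function.comp_def] using this
  have h2 : HasFDerivAt (fun x' => W (t, x')) ((fderiv ℝ W (t, x)).comp
      (ContinuousLinearMap.inr ℝ ℝ X)) x :=
    hW.hasFDerivAt.comp x (hasFDerivAt_prodMk_right t x)
  rw [h1.deriv, h2.fderiv, ContinuousLinearMap.comp_apply, ContinuousLinearMap.inr_apply,
    ← ContinuousLinearMap.map_smul, ← map_add]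
  congr 1
  ext <;> simp

end ChainRule

/-! ### The similarity profile `U₀(s) = eˢ V(e^{2s}/2)(eˢ ·)` of weak-`L³` data -/

namespace BradshawTsai2017

variable {v₀ : EuclideanSpace ℝ (Fin 3) → EuclideanSpace ℝ (Fin 3)}

variable (v₀) in
/-- Unfolding the profile as a dilated slice of the caloric extension:
`U₀(s) = σ • V(σ²/2)(σ ·)`, `σ = eˢ`. [cite: BradshawTsai2017AHP, Lemma 3.4 (3.13)] -/
theorem similarityProfile_eq (s : ℝ) :
    similarityProfile v₀ s =
      fun y => Real.exp s • heatExtension v₀ (Real.exp (2 * s) / 2) (Real.exp s • y) :=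
  rfl

/-- `3 ≠ ∞` in `ℝ≥0∞`. [folklore] -/
theorem three_ne_top_ennreal : (3 : ℝ≥0∞) ≠ ∞ := ENNReal.ofNat_ne_top

/-- **"Inclusion in `C¹` comes from the smoothing effect of the heat kernel"** ([BT1], proof of
Lemma 3.4): for `v₀ ∈ L³_w`, the profile `U₀` is jointly `C^∞` in `(s, y)` — the composition of
the jointly smooth caloric extension on `(0,∞) × ℝ³` with the smooth map
`(s, y) ↦ (e^{2s}/2, eˢy)`, times `eˢ`. [cite: BradshawTsai2017AHP, Lemma 3.4 (proof)] -/
theorem contDiff_uncurry_similarityProfile (hw : MemWeakLp v₀ 3 volume) :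
    ContDiff ℝ (⊤ : ℕ∞) (uncurry (similarityProfile v₀)) := by
  have hW := hw.contDiffOn_heatExtension_prod Nat.one_lt_ofNat three_ne_top_ennreal
  have hΦ : ContDiff ℝ (⊤ : ℕ∞)
      (fun z : ℝ × EuclideanSpace ℝ (Fin 3) => (Real.exp (2 * z.1) / 2, Real.exp z.1 • z.2)) := by
    refine ContDiff.prodMk ?_ ?_
    · exact (Real.contDiff_exp.comp (contDiff_const.mul contDiff_fst)).div_const 2
    · exact (Real.contDiff_exp.comp contDiff_fst).smul contDiff_snd
  have hmaps : ∀ z : ℝ × EuclideanSpace ℝ (Fin 3),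
      (Real.exp (2 * z.1) / 2, Real.exp z.1 • z.2) ∈
        Ioi (0 : ℝ) ×ˢ (univ : Set (EuclideanSpace ℝ (Fin 3))) :=
    fun z => mk_mem_prod (mem_Ioi.2 (by positivity)) (mem_univ _)
  have hcomp := hW.comp_contDiff hΦ hmaps
  have heq : uncurry (similarityProfile v₀) = fun z : ℝ × EuclideanSpace ℝ (Fin 3) => Real.exp z.1 •
      ((fun q : ℝ × EuclideanSpace ℝ (Fin 3) => heatExtension v₀ q.1 q.2) ∘
        fun z : ℝ × EuclideanSpace ℝ (Fin 3) =>
          (Real.exp (2 * z.1) / 2, Real.exp z.1 • z.2)) z := by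
    funext z
    rfl
  rw [heq]
  exact (Real.contDiff_exp.comp contDiff_fst).smul hcomp

/-- The slices `V(t) = e^{tΔ}v₀`, `t > 0`, are `C^∞` for `v₀ ∈ L³_w`. [cite: BradshawTsai2017AHP, Lemma 3.4 (proof)] -/
theorem contDiff_heatExtension_of_memWeakLp (hw : MemWeakLp v₀ 3 volume) {t : ℝ} (ht : 0 < t) :
    ContDiff ℝ (⊤ : ℕ∞) (heatExtension v₀ t) :=
  hw.contDiff_heatExtension Nat.one_lt_ofNat three_ne_top_ennreal ht

/-- The slices `U₀(s)` are `C^∞`. [cite: BradshawTsai2017AHP, Lemma 3.4 (proof)] -/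
theorem contDiff_similarityProfile (hw : MemWeakLp v₀ 3 volume) (s : ℝ) :
    ContDiff ℝ (⊤ : ℕ∞) (similarityProfile v₀ s) := by
  rw [similarityProfile_eq]
  exact ((contDiff_heatExtension_of_memWeakLp hw (by positivity)).comp
    (contDiff_const_smul _)).const_smul _

/-- **"`U₀` is divergence free"** ([BT1], proof of Lemma 3.4): `div U₀(s)(y) = σ² div V(t)(σy) = 0`
for weakly divergence-free `v₀ ∈ L³_w` (`divergence_smul_comp_smul` and
`MemWeakLp.isDivFree_heatExtension`). [cite: BradshawTsai2017AHP, Lemma 3.4 (proof)] -/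
theorem isDivFree_similarityProfile (hw : MemWeakLp v₀ 3 volume) (hdiv : IsWeaklyDivFree v₀)
    (s : ℝ) : VectorCalculus.IsDivFree (similarityProfile v₀ s) := by
  intro y
  have hV := hw.isDivFree_heatExtension Nat.one_lt_ofNat three_ne_top_ennreal hdiv
    (by positivity : 0 < Real.exp (2 * s) / 2)
  rw [similarityProfile_eq, divergence_smul_comp_smul, hV, mul_zero]

variable (v₀) in
/-- `∇U₀(s)(y) = σ² ∇V(t)(σy)` (`fderiv_smul_comp_smul`). [folklore] -/
theorem fderiv_similarityProfile (s : ℝ) (y : EuclideanSpace ℝ (Fin 3)) :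
    fderiv ℝ (similarityProfile v₀ s) y =
      Real.exp s ^ 2 • fderiv ℝ (heatExtension v₀ (Real.exp (2 * s) / 2)) (Real.exp s • y) := by
  rw [similarityProfile_eq, fderiv_smul_comp_smul]

/-- `ΔU₀(s)(y) = σ³ (ΔV(t))(σy)` (`laplacian_smul_comp_smul`). [folklore] -/
theorem laplacian_similarityProfile (hw : MemWeakLp v₀ 3 volume) (s : ℝ)
    (y : EuclideanSpace ℝ (Fin 3)) :
    (Δ (similarityProfile v₀ s)) y =
      Real.exp s ^ 3 • (Δ (heatExtension v₀ (Real.exp (2 * s) / 2))) (Real.exp s • y) := by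
  rw [similarityProfile_eq]
  exact laplacian_smul_comp_smul
    (contDiff_infty.1 (contDiff_heatExtension_of_memWeakLp hw (by positivity)) 2) _ _

/-- **The `s`-derivative of the profile** (chain rule and the heat equation `∂ₜV = ΔV`):
`∂ₛU₀(s)(y) = U₀(s)(y) + σ³ (ΔV(t))(σy) + ∇U₀(s)(y)[y]`, `σ = eˢ`, `t = σ²/2`. [cite: BradshawTsai2017AHP, Lemma 3.4 (proof)] -/
theorem hasDerivAt_similarityProfile (hw : MemWeakLp v₀ 3 volume) (s : ℝ)
    (y : EuclideanSpace ℝ (Fin 3)) :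
    HasDerivAt (fun s' => similarityProfile v₀ s' y)
      (similarityProfile v₀ s y +
        Real.exp s ^ 3 • (Δ (heatExtension v₀ (Real.exp (2 * s) / 2))) (Real.exp s • y) +
        fderiv ℝ (similarityProfile v₀ s) y y) s := by
  set W : ℝ × EuclideanSpace ℝ (Fin 3) → EuclideanSpace ℝ (Fin 3) :=
    fun q => heatExtension v₀ q.1 q.2 with hW_def
  set γ : ℝ → ℝ × EuclideanSpace ℝ (Fin 3) :=
    fun s' => (Real.exp (2 * s') / 2, Real.exp s' • y) with hγ_def
  have hτ : 0 < Real.exp (2 * s) / 2 := by positivity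
  -- the curve `γ`
  have hγ : HasDerivAt γ (Real.exp (2 * s), Real.exp s • y) s := by
    refine HasDerivAt.prodMk ?_ ((Real.hasDerivAt_exp s).smul_const y)
    have h := ((Real.hasDerivAt_exp (2 * s)).comp s ((hasDerivAt_id s).const_mul 2)).div_const 2
    refine h.congr_deriv ?_
    ring
  -- joint differentiability of `W` at `γ s`
  have hWd : DifferentiableAt ℝ W (γ s) := by
    have hS : IsOpen (Ioi (0 : ℝ) ×ˢ (univ : Set (EuclideanSpace ℝ (Fin 3)))) :=
      isOpen_Ioi.prod isOpen_univ
    have hmem : γ s ∈ Ioi (0 : ℝ) ×ˢ (univ : Set (EuclideanSpace ℝ (Fin 3))) :=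
      mk_mem_prod (mem_Ioi.2 hτ) (mem_univ _)
    exact ((hw.contDiffOn_heatExtension_prod Nat.one_lt_ofNat
      three_ne_top_ennreal).differentiableOn (by simp)).differentiableAt (hS.mem_nhds hmem)
  have hcomp : HasDerivAt (W ∘ γ) (fderiv ℝ W (γ s) (Real.exp (2 * s), Real.exp s • y)) s :=
    hWd.hasFDerivAt.comp_hasDerivAt s hγ
  have hprod := (Real.hasDerivAt_exp s).smul hcomp
  have heq : (fun s' => similarityProfile v₀ s' y) = fun s' => Real.exp s' • (W ∘ γ) s' := rfl
  rw [heq]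
  refine hprod.congr_deriv ?_
  -- evaluate the joint derivative
  have hsplit := fderiv_apply_prod_eq_of_differentiableAt hWd (Real.exp (2 * s)) (Real.exp s • y)
  have hheat : deriv (fun τ => W (τ, Real.exp s • y)) (Real.exp (2 * s) / 2) =
      (Δ (heatExtension v₀ (Real.exp (2 * s) / 2))) (Real.exp s • y) :=
    (hw.hasDerivAt_heatExtension_time Nat.one_lt_ofNat three_ne_top_ennreal hτ _).deriv
  have hslice :
      (fun x' => W (Real.exp (2 * s) / 2, x')) = heatExtension v₀ (Real.exp (2 * s) / 2) :=
    rfl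
  have he2 : Real.exp (2 * s) = Real.exp s ^ 2 := by rw [sq, ← Real.exp_add, two_mul]
  rw [show γ s = (Real.exp (2 * s) / 2, Real.exp s • y) from rfl, hsplit, hheat, hslice,
    fderiv_similarityProfile, map_smul,
    show (W ∘ γ) s = heatExtension v₀ (Real.exp (2 * s) / 2) (Real.exp s • y) from rfl,
    similarityProfile_eq, he2]
  simp only [smul_add, smul_smul, FunLike.coe_smul, Pi.smul_apply]
  rw [show Real.exp s * Real.exp s ^ 2 = Real.exp s ^ 3 by ring,
    show Real.exp s * Real.exp s = Real.exp s ^ 2 by ring]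
  abel

/-- **`LU₀ = 0` pointwise** ([BT1], proof of Lemma 3.4: "`LU₀ = ∂ₛU₀ − ΔU₀ − U₀ − y·∇U₀ = 0`
for all `(y,s) ∈ ℝ³ × ℝ`"): `∂ₛU₀ − U₀ − y·∇U₀ = ΔU₀` at every `(s, y)`, with `∂ₛ` the tree's
`timeDeriv` and `y·∇U₀ = ∇U₀(s)(y)[y]`. [cite: BradshawTsai2017AHP, Lemma 3.4 (proof)] -/
theorem timeDeriv_similarityProfile_sub_eq_laplacian (hw : MemWeakLp v₀ 3 volume) (s : ℝ)
    (y : EuclideanSpace ℝ (Fin 3)) :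
    timeDeriv (similarityProfile v₀) s y - similarityProfile v₀ s y -
        fderiv ℝ (similarityProfile v₀ s) y y =
      (Δ (similarityProfile v₀ s)) y := by
  rw [timeDeriv_apply, (hasDerivAt_similarityProfile hw s y).deriv,
    laplacian_similarityProfile hw s y]
  abel

/-- **`LU₀ = 0` in the weak form (2.3)**: for every `s` and every test field `ζ ∈ C_c^∞(ℝ³;ℝ³)`,
`(∂ₛU₀ − U₀ − y·∇U₀, ζ) + (∇U₀, ∇ζ) = 0` (the pointwise identity and Green's first identity
`∫⟪ΔU₀, ζ⟫ + ∫ ∇U₀ : ∇ζ = 0`). [cite: BradshawTsai2017AHP, Lemma 3.4 with (2.3)] -/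
theorem integral_leray_similarityProfile_eq_zero (hw : MemWeakLp v₀ 3 volume) (s : ℝ)
    (ζ : EuclideanSpace ℝ (Fin 3) → EuclideanSpace ℝ (Fin 3))
    (hζ : FunctionSpaces.IsTestFunctionOn (⊤ : Opens (EuclideanSpace ℝ (Fin 3))) ζ) :
    ∫ y, (⟪timeDeriv (similarityProfile v₀) s y - similarityProfile v₀ s y -
        fderiv ℝ (similarityProfile v₀ s) y y, ζ y⟫ +
      frobeniusInner (fderiv ℝ (similarityProfile v₀ s) y) (fderiv ℝ ζ y)) = 0 := by
  simp only [timeDeriv_similarityProfile_sub_eq_laplacian hw s]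
  exact integral_inner_laplacian_add_frobeniusInner_eq_zero
    (contDiff_infty.1 (contDiff_similarityProfile hw s) 2)
    (hζ.contDiff.of_le (by exact_mod_cast le_top)) hζ.hasCompactSupport

/-! ### `L^q` bounds and decay, via periodicity and dilation -/

variable (v₀) in
/-- **Dilation bound for the profile on exterior regions**: for `s ≥ 0`,
`‖U₀(s)‖_{L^q(|y| ≥ R)} ≤ eˢ ‖V(e^{2s}/2)‖_{L^q(|x| ≥ R)}` (`U₀(s) = σ V(t)(σ ·)` with
`σ = eˢ ≥ 1`, `eLpNorm_comp_smul_restrict_compl_ball_le`). [folklore] -/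
theorem eLpNorm_similarityProfile_restrict_le {s : ℝ} (hs : 0 ≤ s) (q : ℝ≥0∞) (R : ℝ) :
    eLpNorm (similarityProfile v₀ s) q (volume.restrict (ball 0 R)ᶜ) ≤
      ENNReal.ofReal (Real.exp s) *
        eLpNorm (heatExtension v₀ (Real.exp (2 * s) / 2)) q
          (volume.restrict (ball 0 R)ᶜ) := by
  have hσ : 1 ≤ Real.exp s := Real.one_le_exp hs
  rw [similarityProfile_eq,
    show (fun y => Real.exp s • heatExtension v₀ (Real.exp (2 * s) / 2) (Real.exp s • y)) =
      Real.exp s • fun y => heatExtension v₀ (Real.exp (2 * s) / 2) (Real.exp s • y) from rfl,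
    eLpNorm_const_smul, Real.enorm_eq_ofReal (Real.exp_pos s).le]
  gcongr
  exact eLpNorm_comp_smul_restrict_compl_ball_le _ q hσ R

variable (v₀) in
/-- Whole-space form: `‖U₀(s)‖_{L^q} ≤ eˢ ‖V(e^{2s}/2)‖_{L^q}` for `s ≥ 0`. [folklore] -/
theorem eLpNorm_similarityProfile_le {s : ℝ} (hs : 0 ≤ s) (q : ℝ≥0∞) :
    eLpNorm (similarityProfile v₀ s) q volume ≤
      ENNReal.ofReal (Real.exp s) * eLpNorm (heatExtension v₀ (Real.exp (2 * s) / 2)) q volume := by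
  have h := eLpNorm_similarityProfile_restrict_le v₀ hs q 0
  rwa [ball_zero, compl_empty, Measure.restrict_univ] at h

/-- **Periodic reduction**: for `λ`-DSS data every slice `U₀(s)` equals a slice `U₀(s')` with
`s' ∈ [0, log λ)` (`U₀` is `log λ`-periodic, `similarityProfile_add_log`). [cite: BradshawTsai2017AHP, Lemma 3.4 (proof)] -/
theorem exists_mem_Ico_similarityProfile_eq {c : ℝ} (hc : 1 < c)
    (hdss : FluidPDE.nsRescaleData c v₀ = v₀) (s : ℝ) :
    ∃ s' ∈ Ico 0 (Real.log c), similarityProfile v₀ s = similarityProfile v₀ s' := by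
  have hper : Function.Periodic (similarityProfile v₀) (Real.log c) := fun s =>
    funext fun y => similarityProfile_add_log (zero_lt_one.trans hc) hdss s y
  exact hper.exists_mem_Ico₀ (Real.log_pos hc) s

/-- For `s ∈ [0, log λ)`: `eˢ ≤ λ` and `e^{2s}/2 ∈ [1/2, λ²/2]`. [folklore] -/
theorem exp_le_and_mem_Icc_of_mem_Ico {c : ℝ} (hc : 1 < c) {s : ℝ} (hs : s ∈ Ico 0 (Real.log c)) :
    Real.exp s ≤ c ∧ Real.exp (2 * s) / 2 ∈ Icc (1 / 2 : ℝ) (c ^ 2 / 2) := by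
  have hc0 : 0 < c := zero_lt_one.trans hc
  refine ⟨?_, ?_, ?_⟩
  · have := Real.exp_le_exp.2 hs.2.le
    rwa [Real.exp_log hc0] at this
  · have : 1 ≤ Real.exp (2 * s) := Real.one_le_exp (by linarith [hs.1])
    linarith
  · have h2 : Real.exp (2 * s) ≤ c ^ 2 := by
      have := Real.exp_le_exp.2 (mul_le_mul_of_nonneg_left hs.2.le zero_le_two)
      rwa [show (2 : ℝ) * Real.log c = Real.log (c ^ 2) by rw [Real.log_pow]; norm_num,
        Real.exp_log (pow_pos hc0 2)] at this
    linarith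

/-- **"`U₀ ∈ L^∞(0,T; L^q(ℝ³))`"** ([BT1], proof of Lemma 3.4, for every `q ∈ (3, ∞]`):
`sup_s ‖U₀(s)‖_{L^q} < ∞` — by periodicity `s ∈ [0, T)`, then
`‖U₀(s)‖_q ≤ λ sup_{t ≥ 1/2} ‖V(t)‖_q < ∞`. [cite: BradshawTsai2017AHP, Lemma 3.4 (proof)] -/
theorem iSup_eLpNorm_similarityProfile_lt_top {c : ℝ} (hc : 1 < c) (hw : MemWeakLp v₀ 3 volume)
    (hdss : FluidPDE.nsRescaleData c v₀ = v₀) {q : ℝ≥0∞} (hq : 3 < q) :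
    ⨆ s, eLpNorm (similarityProfile v₀ s) q volume < ∞ := by
  obtain ⟨M, hM, hMb⟩ := hw.exists_forall_eLpNorm_heatExtension_le Nat.one_lt_ofNat
    three_ne_top_ennreal hq (one_half_pos (α := ℝ))
  refine lt_of_le_of_lt (iSup_le fun s => ?_) (ENNReal.mul_lt_top ENNReal.ofReal_lt_top hM.lt_top :
    ENNReal.ofReal c * M < ∞)
  obtain ⟨s', hs', hss'⟩ := exists_mem_Ico_similarityProfile_eq hc hdss s
  obtain ⟨hexp, hτ⟩ := exp_le_and_mem_Icc_of_mem_Ico hc hs'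
  rw [hss']
  calc eLpNorm (similarityProfile v₀ s') q volume
      ≤ ENNReal.ofReal (Real.exp s') *
          eLpNorm (heatExtension v₀ (Real.exp (2 * s') / 2)) q volume :=
        eLpNorm_similarityProfile_le v₀ hs'.1 q
    _ ≤ ENNReal.ofReal c * M :=
        mul_le_mul' (ENNReal.ofReal_le_ofReal hexp) (hMb _ hτ.1)

/-- **"The last bound in Assumption 2.1 is a direct consequence of Lemma 3.2"** ([BT1], proof of
Lemma 3.4): with `Θ(R) = sup_s ‖U₀(s)‖_{L^q(|y| ≥ R)}` one has `‖U₀(s)‖_{L^q(|y|≥R)} ≤ Θ(R)` and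
`Θ(R) → 0` as `R → ∞` (periodicity, the dilation bound, and the uniform tails of `V(t)`,
`t ∈ [1/2, λ²/2]`). [cite: BradshawTsai2017AHP, Lemma 3.4 with Lemma 3.2] -/
theorem exists_decay_similarityProfile {c : ℝ} (hc : 1 < c) (hw : MemWeakLp v₀ 3 volume)
    (hdss : FluidPDE.nsRescaleData c v₀ = v₀) {q : ℝ≥0∞} (hq : 3 < q) :
    ∃ Θ : ℝ → ℝ≥0∞, Tendsto Θ atTop (𝓝 0) ∧
      ∀ s R, eLpNorm (similarityProfile v₀ s) q (volume.restrict (ball 0 R)ᶜ) ≤ Θ R := by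
  refine ⟨fun R => ⨆ s, eLpNorm (similarityProfile v₀ s) q (volume.restrict (ball 0 R)ᶜ),
    ?_, fun s R => le_iSup
      (fun s => eLpNorm (similarityProfile v₀ s) q (volume.restrict (ball 0 R)ᶜ)) s⟩
  rw [ENNReal.tendsto_atTop_zero]
  intro ε hε
  have hc0 : 0 < c := zero_lt_one.trans hc
  have hcne : ENNReal.ofReal c ≠ 0 := (ENNReal.ofReal_pos.2 hc0).ne'
  have hε' : 0 < ε / ENNReal.ofReal c := ENNReal.div_pos hε.ne' ENNReal.ofReal_ne_top
  have h01 : (1 / 2 : ℝ) ≤ c ^ 2 / 2 := by nlinarith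
  obtain ⟨R₀, hR₀⟩ := hw.exists_forall_eLpNorm_heatExtension_restrict_compl_ball_le
    Nat.one_lt_ofNat three_ne_top_ennreal hq (one_half_pos (α := ℝ)) h01 hε'
  refine ⟨R₀, fun R hR => iSup_le fun s => ?_⟩
  obtain ⟨s', hs', hss'⟩ := exists_mem_Ico_similarityProfile_eq hc hdss s
  obtain ⟨hexp, hτ⟩ := exp_le_and_mem_Icc_of_mem_Ico hc hs'
  rw [hss']
  calc eLpNorm (similarityProfile v₀ s') q (volume.restrict (ball 0 R)ᶜ)
      ≤ ENNReal.ofReal (Real.exp s') * eLpNorm (heatExtension v₀ (Real.exp (2 * s') / 2)) q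
          (volume.restrict (ball 0 R)ᶜ) :=
        eLpNorm_similarityProfile_restrict_le v₀ hs'.1 q R
    _ ≤ ENNReal.ofReal c * (ε / ENNReal.ofReal c) :=
        mul_le_mul' (ENNReal.ofReal_le_ofReal hexp) (hR₀ R hR _ hτ)
    _ = ε := ENNReal.mul_div_cancel hcne ENNReal.ofReal_ne_top

/-! ### Lemma 3.4 -/

/-- **[BT1] Lemma 3.4, discharged.** For `λ > 1` and a weakly divergence-free `λ`-DSS datum
`v₀ ∈ L³_w(ℝ³)`, the profile `U₀(y,s) = √(2t)(e^{tΔ}v₀)(x)` satisfies Assumption 2.1 with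
`T = log λ` and every `q ∈ (3, ∞]`: `C¹` (indeed `C^∞`) jointly, `T`-periodic, divergence free,
`LU₀ = 0` in the form (2.3), `U₀ ∈ L^∞(0,T; L⁴ ∩ L^q)`, and
`sup_s ‖U₀(s)‖_{L^q(|y| ≥ R)} ≤ Θ(R) → 0`. [cite: BradshawTsai2017AHP, Lemma 3.4] -/
theorem _root_.Literature.Analysis.FluidPDE.bradshawTsai2017_lemma_3_4_holds :
    bradshawTsai2017_lemma_3_4 := by
  intro c hc v₀ hw hdiv hdss q hq
  exact
    { contDiff := (contDiff_uncurry_similarityProfile hw).of_le (by exact_mod_cast le_top)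
      periodic := fun s y => similarityProfile_add_log (zero_lt_one.trans hc) hdss s y
      divFree := isDivFree_similarityProfile hw hdiv
      leray := fun s ζ hζ => integral_leray_similarityProfile_eq_zero hw s ζ hζ
      memL4 := iSup_eLpNorm_similarityProfile_lt_top hc hw hdss (by norm_num)
      memLq := iSup_eLpNorm_similarityProfile_lt_top hc hw hdss hq
      decay := exists_decay_similarityProfile hc hw hdss hq }

end BradshawTsai2017

/-! ### [BT1] §4 ¶1–3: suitability on the slab and the ansatz transport, assembled -/

namespace BradshawTsai2017

section AnsatzTransport

variable {T : ℝ} {q : ℝ≥0∞}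
  {U₀ u : ℝ → EuclideanSpace ℝ (Fin 3) → EuclideanSpace ℝ (Fin 3)}
  {p : ℝ → EuclideanSpace ℝ (Fin 3) → ℝ}

/-- **`∇v ∈ L²_loc` on the slab**: for the weak gradient `G = ∇u` of Definition 2.2 (square
integrable on compact subsets of `ℝ × ℝ³`, `setLIntegral_frobeniusNormSq_lt_top_of_isCompact`),
its physical image `physGradient G = ∇_x v` has `∫_K |∇v|² = ∫_{Φ⁻¹K} eˢ |∇u|² < ∞` for every
compact `K` in the slab. [cite: BradshawTsai2017AHP, §4 (proof of Thm 1.2)] -/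
theorem IsSuitablePeriodicWeakSolution.setLIntegral_frobeniusNormSq_physGradient_lt_top
    (hT : 0 < T) (hA : ProfileAssumption T q U₀) (hS : IsSuitablePeriodicWeakSolution T U₀ u p)
    {G : ℝ → EuclideanSpace ℝ (Fin 3) → EuclideanSpace ℝ (Fin 3) →L[ℝ] EuclideanSpace ℝ (Fin 3)}
    (hG : HasWeakSpatialGradientOn (⊤ : Opens (ℝ × EuclideanSpace ℝ (Fin 3))) u G)
    (hGL2 : ∫⁻ z in Ioo 0 T ×ˢ (univ : Set (EuclideanSpace ℝ (Fin 3))),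
      ENNReal.ofReal (frobeniusNormSq (G z.1 z.2 - fderiv ℝ (U₀ z.1) z.2)) < ∞)
    (K : Set (ℝ × EuclideanSpace ℝ (Fin 3)))
    (hK : K ⊆ ((slab (EuclideanSpace ℝ (Fin 3)) (Ioi 0) isOpen_Ioi :
      Opens (ℝ × EuclideanSpace ℝ (Fin 3))) : Set (ℝ × EuclideanSpace ℝ (Fin 3))))
    (hKc : IsCompact K) :
    ∫⁻ z in K, ENNReal.ofReal (frobeniusNormSq (physGradient G z.1 z.2)) < ∞ := by
  have hK' : K ⊆ Ioi (0 : ℝ) ×ˢ (univ : Set (EuclideanSpace ℝ (Fin 3))) := hK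
  have hKi : K ∩ Ioi (0 : ℝ) ×ˢ (univ : Set (EuclideanSpace ℝ (Fin 3))) = K := inter_eq_left.2 hK'
  have hcov := setLIntegral_inter_slab_eq_simMap
    (fun z : ℝ × EuclideanSpace ℝ (Fin 3) => ENNReal.ofReal (frobeniusNormSq (physGradient G z.1 z.2)))
    hKc.measurableSet
  rw [hKi] at hcov
  rw [hcov]
  simp_rw [simDensity_mul_frobeniusNormSq_physGradient]
  have hKp : IsCompact ((simMap : ℝ × EuclideanSpace ℝ (Fin 3) → ℝ × EuclideanSpace ℝ (Fin 3)) ⁻¹' K) :=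
    isCompact_preimage_simMap hKc hK'
  obtain ⟨B, hB⟩ := hKp.exists_bound_of_continuousOn
    ((Real.continuous_exp.comp continuous_fst).continuousOn :
      ContinuousOn (fun z : ℝ × EuclideanSpace ℝ (Fin 3) => Real.exp z.1) _)
  calc ∫⁻ z in simMap ⁻¹' K, ENNReal.ofReal (Real.exp z.1) * ENNReal.ofReal (frobeniusNormSq (G z.1 z.2))
      ≤ ∫⁻ z in simMap ⁻¹' K, ENNReal.ofReal B * ENNReal.ofReal (frobeniusNormSq (G z.1 z.2)) := by
        refine setLIntegral_mono' hKp.measurableSet fun z hz => ?_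
        refine mul_le_mul' (ENNReal.ofReal_le_ofReal ?_) le_rfl
        exact (le_abs_self _).trans ((Real.norm_eq_abs _).symm.le.trans (hB z hz))
    _ = ENNReal.ofReal B * ∫⁻ z in simMap ⁻¹' K, ENNReal.ofReal (frobeniusNormSq (G z.1 z.2)) :=
        lintegral_const_mul' _ _ ENNReal.ofReal_ne_top
    _ < ∞ := ENNReal.mul_lt_top ENNReal.ofReal_lt_top
        (setLIntegral_frobeniusNormSq_lt_top_of_isCompact hT hA hS hG hGL2 hKp)

/-- **[BT1] §4 ¶1–3: the physical pair is a suitable weak solution on the slab `t > 0`.** For a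
suitable periodic weak solution `(u, p)` with profile `U₀` under Assumption 2.1 (`T > 0`), the pair
`v = physVelocity u`, `π = physPressure p` is a suitable weak solution of Navier–Stokes
(`ν = 1`, `f = 0`) on `(0,∞) × ℝ³` in the sense of Caffarelli–Kohn–Nirenberg
(`IsSuitableWeakSolutionOn`): distributional solution (§4 ¶1), `v ∈ L^∞_t L²_x` and
`π ∈ L^{3/2}` locally, and — with the weak gradient `∇v = physGradient ∇u` — `∇v ∈ L²_loc` and the
local energy inequality (2.5) ("inherited from the suitability of `(u,p)`", §4 last paragraph). [cite: BradshawTsai2017AHP, §4 (proof of Thm 1.2) ¶1–3 and last paragraph] -/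
theorem IsSuitablePeriodicWeakSolution.isSuitableWeakSolutionOn_phys (hT : 0 < T)
    (hA : ProfileAssumption T q U₀) (hS : IsSuitablePeriodicWeakSolution T U₀ u p) :
    IsSuitableWeakSolutionOn (slab (EuclideanSpace ℝ (Fin 3)) (Ioi 0) isOpen_Ioi) 1 0
      (physVelocity u) (physPressure p) := by
  obtain ⟨G, hG, hGL2, -, -⟩ := hS.weakForm
  exact
    { distributional := hS.isDistributionalNSSolutionOn_phys hA.contDiff.continuous
      energyClass := fun K hK hKc => hS.energyClass_phys hA.contDiff.continuous K hK hKc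
      pressure := fun K hK hKc => hS.pressure_threeHalves_phys K hK hKc
      localEnergy := ⟨physGradient G, hasWeakSpatialGradientOn_physVelocity hG,
        fun K hK hKc => hS.setLIntegral_frobeniusNormSq_physGradient_lt_top hT hA hG hGL2 K hK hKc,
        fun φ hφ hφ0 => hS.localEnergyInequality_phys hT hA hG hφ hφ0⟩ }

/-- **[BT1] §4, proof of Theorem 1.2, ¶1–3 and last paragraph — discharged.** For `λ > 1`,
`T = log λ`, a profile `U₀ = similarityProfile v₀` satisfying Assumption 2.1 ("By Lemma 3.4"),
and a suitable periodic weak solution `(u,p)` of the Leray system with period `T` and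
`p ∈ L^{5/3}(ℝ³ × [0,T])` ("described in Theorem 2.4"), the pair `v(x,t) = u(y,s)/√(2t)`,
`π(x,t) = p(y,s)/2t` (`physVelocity u`, `physPressure p`) is an ansatz pair
`IsAnsatzSolution λ v₀ v π`: `v`, `π` are `λ`-DSS (`T`-periodicity), `(v,π)` is a suitable weak
solution on the slab `t > 0` (`isSuitableWeakSolutionOn_phys`),
`v − e^{tΔ}v₀ ∈ L^∞(1,λ²;L²(ℝ³)) ∩ L²(1,λ²;H¹(ℝ³))` (`energy_sub_heat_phys`,
`gradient_sub_heat_phys`), and `π ∈ L^{5/3}((1,λ²) × ℝ³)` (`pressure_five_thirds_phys`). [cite: BradshawTsai2017AHP, §4 (proof of Thm 1.2) ¶1–3] -/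
theorem _root_.Literature.Analysis.FluidPDE.bradshawTsai2017_ansatz_transport_holds :
    bradshawTsai2017_ansatz_transport := by
  intro c hc v₀ q hA u p hS hp
  have hc0 : 0 < c := zero_lt_one.trans hc
  have hT : 0 < Real.log c := Real.log_pos hc
  exact
    { dss := isDiscretelySelfSimilar_physVelocity hc0 hS.periodic
      dss_pressure := nsRescalePressure_physPressure hc0 hS.periodic_pressure
      suitable := hS.isSuitableWeakSolutionOn_phys hT hA
      energy_sub_heat := hS.energy_sub_heat_phys c
      gradient_sub_heat := hS.gradient_sub_heat_phys hc hA
      pressure_five_thirds := hS.pressure_five_thirds_phys hc hp }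

end AnsatzTransport

end BradshawTsai2017

end Literature.Analysis.FluidPDE

end
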